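import Literature.Geometry.GeometricMeasureTheory.Currents
import Mathlib.MeasureTheory.Function.Jacobian
import Mathlib.MeasureTheory.Covering.BesicovitchVectorSpace
import Mathlib.Analysis.Calculus.FDeriv.Measurable
import Mathlib.Analysis.Normed.Module.FiniteDimension
import HarnessLib

/-!
# Approximate tangent cones of Lipschitz images contain the image of the differential

Support file for the proof of Federer's support theorem for integral flat chains
(`Literature.Geometry.GeometricMeasureTheory.Federer1969_support_integralFlatChain`). Everything
here is proved from Mathlib and `Currents.lean`; no named facts, no definitions.

**Theorem** (`fderiv_apply_mem_posTangentConeAt_ae`). Let `g : ℝ^ι → V` be Lipschitz into a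
finite-dimensional real normed space, `W ⊆ V` measurable, `d = #ι`, `μ = 𝓗ᵈ ⌞ W`. For
Lebesgue-a.e. `u` with `g u ∈ W` at which `g` is differentiable with injective differential:
for every `S ⊆ V` with `Θ*ᵈ(μ ⌞ Sᶜ, g u) = 0`, the whole subspace `Dg(u)(ℝ^ι)` lies in the
tangent cone `Tan(S, g u)` (Mathlib's `posTangentConeAt S (g u)`). Consequently `Dg(u)(ℝ^ι)`
is contained in the approximate tangent cone `Tan^d(𝓗ᵈ ⌞ W, g u) = ⋂_S Tan(S, g u)` of
`Currents.lean` (`approxTangentCone`), which is Federer's 3.2.19 (the inclusion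
`im Dg(u) ⊆ Tan^d`) in the form needed for the support theorem.

## The proof (Federer 3.2.16–3.2.19, direct)

Countably many pieces `P` on which `g` is bi-Lipschitz cover the set of good parameters
(Mathlib's `exists_partition_approximatesLinearOn_of_hasFDerivWithinAt` applied on
`{u : ‖Dg(u) v‖ ≥ c ‖v‖}`), and a.e. point of a piece is a Lebesgue density point of it
(`Besicovitch.ae_tendsto_measure_inter_div`). At such a point `u`, if `w = Dg(u) v` were not in
`Tan(S, g u)`, a cone neighbourhood of the direction `w` near `g u` would miss `S`
(`exists_forall_le_norm_smul_sub_of_notMem_posTangentConeAt`); but `g` maps the part of `P` in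
the small ball `B(u + r v, η r)` — of volume `≥ ½ (2 η r)ᵈ` by density — into that cone
neighbourhood, bi-Lipschitzly, producing mass `≥ κ rᵈ` of `𝓗ᵈ ⌞ W ⌞ Sᶜ` in `B(g u, M r)` for
all small `r`, i.e. a positive upper density: contradiction.

## References

* H. Federer, *Geometric Measure Theory*, Springer 1969, 3.2.16, 3.2.19.
-/

noncomputable section

open MeasureTheory MeasureTheory.Measure Set Function Filter Metric Module
open scoped ENNReal NNReal Topology Pointwise

namespace Literature.Geometry.GeometricMeasureTheory

/-! ### Unpacking the tangent cone -/

section TangentCone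

variable {V : Type*} [NormedAddCommGroup V] [NormedSpace ℝ V]

/-- If `w ∉ Tan(S, x)` then some cone neighbourhood of the direction `w` misses `S` near `x`:
there are `ε, δ > 0` such that `‖c • d - w‖ ≥ ε` for all `c ≥ 0` whenever `‖d‖ < δ` and
`x + d ∈ S` (the negation of Federer's definition 3.1.21 of `Tan(S, x)`, for Mathlib's
`posTangentConeAt S x = tangentConeAt ℝ≥0 S x`). [cite: Federer1969, 3.1.21] -/
theorem exists_forall_le_norm_smul_sub_of_notMem_posTangentConeAt {S : Set V} {x w : V}
    (hw : w ∉ posTangentConeAt S x) :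
    ∃ ε > 0, ∃ δ > 0, ∀ d : V, ‖d‖ < δ → x + d ∈ S → ∀ c : ℝ, 0 ≤ c → ε ≤ ‖c • d - w‖ := by
  change w ∉ tangentConeAt ℝ≥0 S x at hw
  rw [tangentConeAt_def, mem_setOf_eq, clusterPt_iff_nonempty] at hw
  push Not at hw
  obtain ⟨U, hU, A, hA, hUA⟩ := hw
  obtain ⟨ε, hε, hball⟩ := Metric.mem_nhds_iff.1 hU
  obtain ⟨t₁, ht₁, t₂, ht₂, hsub⟩ := Filter.mem_smul.1 hA
  obtain ⟨δ, hδ, hδsub⟩ := Metric.mem_nhdsWithin_iff.1 ht₂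
  refine ⟨ε, hε, δ, hδ, fun d hd hdS c hc => ?_⟩
  by_contra hlt
  push Not at hlt
  have hd₂ : d ∈ t₂ := hδsub ⟨mem_ball_zero_iff.2 hd, hdS⟩
  have hc₁ : (⟨c, hc⟩ : ℝ≥0) ∈ t₁ := by
    rw [Filter.mem_top.1 ht₁]
    trivial
  have h1 : (⟨c, hc⟩ : ℝ≥0) • d ∈ A := hsub (Set.smul_mem_smul hc₁ hd₂)
  have e : (⟨c, hc⟩ : ℝ≥0) • d = c • d := rfl
  have h2 : (⟨c, hc⟩ : ℝ≥0) • d ∈ U := hball (by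
    rw [mem_ball, dist_eq_norm, e]
    exact hlt)
  have : (⟨c, hc⟩ : ℝ≥0) • d ∈ U ∩ A := ⟨h2, h1⟩
  rw [hUA] at this
  exact this

end TangentCone

/-! ### Bi-Lipschitz pieces do not lose Hausdorff measure -/

section Antilipschitz

/-- If `f` is anti-Lipschitz with constant `K` on `P`, then `μH[d] Q ≤ Kᵈ μH[d] (f '' Q)` for
every `Q ⊆ P` (Mathlib's `AntilipschitzWith.hausdorffMeasure_preimage_le` on the subtype `P`,
whose Hausdorff measure is the restriction of the ambient one). [folklore] -/
theorem hausdorffMeasure_le_mul_image_of_antilipschitz_restrict {X Y : Type*} [EMetricSpace X]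
    [MeasurableSpace X] [BorelSpace X] [EMetricSpace Y] [MeasurableSpace Y] [BorelSpace Y]
    {f : X → Y} {P Q : Set X} {K : ℝ≥0} (hf : AntilipschitzWith K (P.restrict f)) {d : ℝ}
    (hd : 0 ≤ d) (hQ : Q ⊆ P) : μH[d] Q ≤ (K : ℝ≥0∞) ^ d * μH[d] (f '' Q) := by
  have h1 : Q = (Subtype.val : P → X) '' {p : P | (p : X) ∈ Q} := by
    ext y
    simp only [mem_image, mem_setOf_eq, Subtype.exists, exists_and_right, exists_eq_right]
    exact ⟨fun hy => ⟨hQ hy, hy⟩, fun ⟨_, hy⟩ => hy⟩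
  have h2 : μH[d] ((Subtype.val : P → X) '' {p : P | (p : X) ∈ Q}) =
      μH[d] {p : P | (p : X) ∈ Q} :=
    (isometry_subtype_coe).hausdorffMeasure_image (Or.inl hd) _
  have h3 : {p : P | (p : X) ∈ Q} ⊆ (P.restrict f) ⁻¹' (f '' Q) := fun p hp => ⟨p, hp, rfl⟩
  calc μH[d] Q = μH[d] {p : P | (p : X) ∈ Q} := by rw [h1, h2]; rw [← h1]
    _ ≤ μH[d] ((P.restrict f) ⁻¹' (f '' Q)) := measure_mono h3
    _ ≤ (K : ℝ≥0∞) ^ d * μH[d] (f '' Q) := hf.hausdorffMeasure_preimage_le hd _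

end Antilipschitz

/-! ### The core density argument -/

section Core

variable {ι : Type*} [Fintype ι] {V : Type*} [NormedAddCommGroup V] [NormedSpace ℝ V]
  [MeasurableSpace V] [BorelSpace V]

/-- The volume `α(d)` of the unit ball of `ℝᵈ` is positive and finite. [folklore] -/
theorem unitBallVolume_ne_zero_ne_top (d : ℕ) : unitBallVolume d ≠ 0 ∧ unitBallVolume d ≠ ⊤ :=
  ⟨(measure_ball_pos volume (0 : EuclideanSpace ℝ (Fin d)) one_pos).ne', measure_ball_lt_top.ne⟩

/-- **The density argument** (Federer 3.2.19 at one point). Let `P ⊆ ℝ^ι` be measurable, `g`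
anti-Lipschitz on `P` with `g(P) ⊆ W`, `u` a Lebesgue density point of `P` at which `g` is
differentiable, and `S ⊆ V` with `Θ*ᵈ(𝓗ᵈ ⌞ W ⌞ Sᶜ, g u) = 0`. Then `Dg(u) v ∈ Tan(S, g u)` for
every `v`. [cite: Federer1969, 3.2.19] -/
theorem fderiv_apply_mem_posTangentConeAt_of_density {g : (ι → ℝ) → V} {P : Set (ι → ℝ)}
    (hPm : MeasurableSet P) {K : ℝ≥0} (hK : AntilipschitzWith K (P.restrict g)) {W : Set V}
    (hPW : MapsTo g P W) {u : ι → ℝ} (hdiff : DifferentiableAt ℝ g u)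
    (hdens : Tendsto (fun r => volume (P ∩ closedBall u r) / volume (closedBall u r))
      (𝓝[>] 0) (𝓝 1))
    {S : Set V} (hS : upperDensity (Fintype.card ι)
      (((μH[Fintype.card ι] : Measure V).restrict W).restrict Sᶜ) (g u) = 0) (v : ι → ℝ) :
    fderiv ℝ g u v ∈ posTangentConeAt S (g u) := by
  set d := Fintype.card ι with hd_def
  set x := g u with hx
  set T := fderiv ℝ g u with hT
  set w := T v with hw_def
  set ν : Measure V := (((μH[d] : Measure V).restrict W).restrict Sᶜ) with hν
  by_contra hw
  obtain ⟨ε₀, hε₀, δ, hδ, hcone⟩ := exists_forall_le_norm_smul_sub_of_notMem_posTangentConeAt hw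
  -- WLOG `ε ≤ 1`
  set ε := min ε₀ 1 with hε_def
  have hε : 0 < ε := lt_min hε₀ one_pos
  have hε1 : ε ≤ 1 := min_le_right _ _
  have hcone' : ∀ d' : V, ‖d'‖ < δ → x + d' ∈ S → ∀ c : ℝ, 0 ≤ c → ε ≤ ‖c • d' - w‖ :=
    fun d' hd' hS' c hc => (min_le_left _ _).trans (hcone d' hd' hS' c hc)
  -- constants
  set Cv : ℝ := ‖T‖ + ‖v‖ + 1 with hCv
  have hCv0 : 0 < Cv := by positivity
  set η : ℝ := min 1 (ε / (2 * Cv)) with hη_def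
  have hη : 0 < η := lt_min one_pos (by positivity)
  have hη1 : η ≤ 1 := min_le_left _ _
  have hηC : η * Cv ≤ ε / 2 := by
    have : η ≤ ε / (2 * Cv) := min_le_right _ _
    rw [le_div_iff₀ (by positivity)] at this
    linarith
  set M : ℝ := ‖w‖ + 1 with hM
  have hM0 : 0 < M := by positivity
  -- differentiability at `u` at precision `η`
  obtain ⟨r₀, hr₀, happrox⟩ : ∃ r₀ : ℝ, 0 < r₀ ∧ ∀ y, dist y u < r₀ →
      ‖g y - g u - T (y - u)‖ ≤ η * ‖y - u‖ := by
    obtain ⟨r₀, hr₀, h⟩ := Metric.eventually_nhds_iff.1 (hdiff.hasFDerivAt.isLittleO.def hη)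
    exact ⟨r₀, hr₀, fun y hy => h hy⟩
  -- density of `P` at `u` at precision `θ`
  set θ : ℝ := (1 / 2) * (η / (‖v‖ + 1)) ^ d with hθ
  have hθ0 : 0 < θ := by positivity
  have hθ1 : θ < 1 := by
    have h1 : (η / (‖v‖ + 1)) ^ d ≤ 1 := by
      refine pow_le_one₀ (by positivity) ?_
      rw [div_le_one (by positivity)]
      linarith [norm_nonneg v]
    rw [hθ]
    linarith
  have hdens' : ∀ᶠ r in 𝓝[>] (0 : ℝ), ENNReal.ofReal (1 - θ) <
      volume (P ∩ closedBall u ((‖v‖ + 1) * r)) / volume (closedBall u ((‖v‖ + 1) * r)) := by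
    have hsc : Tendsto (fun r : ℝ => (‖v‖ + 1) * r) (𝓝[>] 0) (𝓝[>] 0) := by
      refine tendsto_nhdsWithin_iff.2 ⟨?_, ?_⟩
      · have : Tendsto (fun r : ℝ => (‖v‖ + 1) * r) (𝓝 0) (𝓝 ((‖v‖ + 1) * 0)) :=
          tendsto_const_nhds.mul tendsto_id
        rw [mul_zero] at this
        exact this.mono_left nhdsWithin_le_nhds
      · filter_upwards [self_mem_nhdsWithin] with r hr
        change 0 < (‖v‖ + 1) * r
        exact mul_pos (by positivity) hr
    have h1 : ENNReal.ofReal (1 - θ) < 1 := by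
      rw [← ENNReal.ofReal_one]
      exact (ENNReal.ofReal_lt_ofReal_iff one_pos).2 (by linarith)
    exact hsc.eventually (Tendsto.eventually_const_lt h1 hdens)
  -- the good radii
  have hgood : ∀ᶠ r in 𝓝[>] (0 : ℝ), 0 < r ∧ (‖v‖ + 1) * r < r₀ ∧ M * r < δ ∧
      ENNReal.ofReal (1 - θ) <
        volume (P ∩ closedBall u ((‖v‖ + 1) * r)) / volume (closedBall u ((‖v‖ + 1) * r)) := by
    have h1 : ∀ᶠ r in 𝓝[>] (0 : ℝ), 0 < r := self_mem_nhdsWithin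
    have h2 : ∀ᶠ r in 𝓝[>] (0 : ℝ), (‖v‖ + 1) * r < r₀ := by
      have : Ioo (0 : ℝ) (r₀ / (‖v‖ + 1)) ∈ 𝓝[>] (0 : ℝ) := Ioo_mem_nhdsGT (by positivity)
      filter_upwards [this] with r hr
      rw [mul_comm, ← lt_div_iff₀ (by positivity)]
      exact hr.2
    have h3 : ∀ᶠ r in 𝓝[>] (0 : ℝ), M * r < δ := by
      have : Ioo (0 : ℝ) (δ / M) ∈ 𝓝[>] (0 : ℝ) := Ioo_mem_nhdsGT (by positivity)
      filter_upwards [this] with r hr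
      rw [mul_comm, ← lt_div_iff₀ hM0]
      exact hr.2
    filter_upwards [h1, h2, h3, hdens'] with r h1 h2 h3 h4 using ⟨h1, h2, h3, h4⟩
  -- the positive constant `κ`
  set κ : ℝ≥0∞ := (ENNReal.ofReal ((2 * η) ^ d / 2) / (K : ℝ≥0∞) ^ d) /
    (unitBallVolume d * ENNReal.ofReal (M ^ d)) with hκ
  have hκ0 : κ ≠ 0 := by
    rw [hκ, Ne, ENNReal.div_eq_zero_iff, not_or, ENNReal.div_eq_zero_iff, not_or]
    refine ⟨⟨?_, ENNReal.pow_ne_top ENNReal.coe_ne_top⟩,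
      ENNReal.mul_ne_top (unitBallVolume_ne_zero_ne_top d).2 ENNReal.ofReal_ne_top⟩
    rw [ENNReal.ofReal_eq_zero, not_le]
    positivity
  -- the key lower bound at every good radius
  have hkey : ∀ r, 0 < r → (‖v‖ + 1) * r < r₀ → M * r < δ →
      ENNReal.ofReal (1 - θ) <
        volume (P ∩ closedBall u ((‖v‖ + 1) * r)) / volume (closedBall u ((‖v‖ + 1) * r)) →
      κ ≤ ν (closedBall x (M * r)) / (unitBallVolume d * ENNReal.ofReal ((M * r) ^ d)) := by
    intro r hr hr0 hrδ hrθ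
    set Q := P ∩ closedBall (u + r • v) (η * r) with hQ
    set B := closedBall u ((‖v‖ + 1) * r) with hB
    have hQB : closedBall (u + r • v) (η * r) ⊆ B := by
      intro y hy
      rw [mem_closedBall] at hy ⊢
      calc dist y u ≤ dist y (u + r • v) + dist (u + r • v) u := dist_triangle _ _ _
        _ ≤ η * r + ‖v‖ * r := by
            refine add_le_add hy (le_of_eq ?_)
            rw [dist_eq_norm, add_sub_cancel_left, norm_smul, Real.norm_of_nonneg hr.le, mul_comm]
        _ ≤ (‖v‖ + 1) * r := by
            have := mul_le_mul_of_nonneg_right hη1 hr.le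
            linarith
    -- (1) `g` maps `Q` into `B(x, M r) ∩ Sᶜ ∩ W`
    have hmaps : g '' Q ⊆ closedBall x (M * r) ∩ Sᶜ ∩ W := by
      rintro _ ⟨y, ⟨hyP, hyb⟩, rfl⟩
      have hyu : dist y u < r₀ := lt_of_le_of_lt (mem_closedBall.1 (hQB hyb)) hr0
      have e1 : g y - x - r • w = (g y - g u - T (y - u)) + T (y - (u + r • v)) := by
        rw [hw_def, ← T.map_smul, hx]
        have : T (y - u) = T (y - (u + r • v)) + T (r • v) := by
          rw [← T.map_add]; congr 1; abel
        rw [this]; abel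
      have e2 : ‖g y - x - r • w‖ ≤ ε / 2 * r := by
        rw [e1]
        calc ‖(g y - g u - T (y - u)) + T (y - (u + r • v))‖
            ≤ ‖g y - g u - T (y - u)‖ + ‖T (y - (u + r • v))‖ := norm_add_le _ _
          _ ≤ η * ‖y - u‖ + ‖T‖ * ‖y - (u + r • v)‖ :=
              add_le_add (happrox y hyu) (T.le_opNorm _)
          _ ≤ η * ((‖v‖ + 1) * r) + ‖T‖ * (η * r) := by
              gcongr
              · rw [← dist_eq_norm]; exact mem_closedBall.1 (hQB hyb)
              · rw [← dist_eq_norm]; exact mem_closedBall.1 hyb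
          _ = (η * Cv) * r := by rw [hCv]; ring
          _ ≤ ε / 2 * r := mul_le_mul_of_nonneg_right hηC hr.le
      have e3 : ‖g y - x‖ ≤ M * r := by
        calc ‖g y - x‖ = ‖(g y - x - r • w) + r • w‖ := by rw [sub_add_cancel]
          _ ≤ ‖g y - x - r • w‖ + ‖r • w‖ := norm_add_le _ _
          _ ≤ ε / 2 * r + r * ‖w‖ := by
              rw [norm_smul, Real.norm_of_nonneg hr.le]
              exact add_le_add e2 le_rfl
          _ ≤ M * r := by
              have : ε / 2 * r ≤ 1 * r := mul_le_mul_of_nonneg_right (by linarith) hr.le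
              rw [hM]; linarith
      refine ⟨⟨?_, fun hyS => ?_⟩, hPW hyP⟩
      · rw [mem_closedBall, dist_eq_norm]
        exact e3
      · -- `g y ∈ S` contradicts the cone condition with `c = 1/r`
        have h1 := hcone' (g y - x) (lt_of_le_of_lt e3 hrδ) (by rwa [add_sub_cancel]) (1 / r)
          (by positivity)
        have h2 : ‖(1 / r) • (g y - x) - w‖ ≤ ε / 2 := by
          have : (1 / r) • (g y - x) - w = (1 / r) • (g y - x - r • w) := by
            rw [smul_sub (1 / r) (g y - x) (r • w), smul_smul, one_div_mul_cancel hr.ne', one_smul]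
          rw [this, norm_smul, Real.norm_of_nonneg (by positivity : (0 : ℝ) ≤ 1 / r)]
          calc 1 / r * ‖g y - x - r • w‖ ≤ 1 / r * (ε / 2 * r) :=
                mul_le_mul_of_nonneg_left e2 (by positivity)
            _ = ε / 2 := by field_simp
        linarith
    -- (2) hence `ν (B(x, M r)) ≥ μH[d] (g '' Q)`
    have hν : μH[d] (g '' Q) ≤ ν (closedBall x (M * r)) := by
      calc μH[d] (g '' Q) ≤ μH[d] ((closedBall x (M * r) ∩ Sᶜ) ∩ W) := measure_mono hmaps
        _ ≤ ((μH[d] : Measure V).restrict W) (closedBall x (M * r) ∩ Sᶜ) := le_restrict_apply _ _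
        _ ≤ ν (closedBall x (M * r)) := le_restrict_apply _ _
    -- (3) the bi-Lipschitz lower bound and `μH[d] = volume` on `ℝ^ι`
    have hanti : μH[d] Q ≤ (K : ℝ≥0∞) ^ d * μH[d] (g '' Q) := by
      have := hausdorffMeasure_le_mul_image_of_antilipschitz_restrict (Q := Q) hK
        (Nat.cast_nonneg d) (by rw [hQ]; exact inter_subset_left)
      rwa [ENNReal.rpow_natCast] at this
    have hQvol : (μH[d] : Measure (ι → ℝ)) Q = volume Q := by
      rw [hd_def, hausdorffMeasure_pi_real]
    -- (4) the volume of `Q` from the density estimate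
    have hvolB : volume B = ENNReal.ofReal ((2 * ((‖v‖ + 1) * r)) ^ d) :=
      Real.volume_pi_closedBall u (by positivity)
    have hvolb : volume (closedBall (u + r • v) (η * r)) = ENNReal.ofReal ((2 * (η * r)) ^ d) :=
      Real.volume_pi_closedBall _ (by positivity)
    have hBtop : volume B ≠ ⊤ := by rw [hvolB]; exact ENNReal.ofReal_ne_top
    have hB0 : volume B ≠ 0 := by
      rw [hvolB, Ne, ENNReal.ofReal_eq_zero, not_le]; positivity
    have hPB : ENNReal.ofReal (1 - θ) * volume B ≤ volume (P ∩ B) := by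
      rw [← ENNReal.le_div_iff_mul_le (Or.inl hB0) (Or.inl hBtop)]
      exact hrθ.le
    have hdiffP : volume (B \ P) ≤ ENNReal.ofReal ((2 * (η * r)) ^ d / 2) := by
      have hb : 0 < (2 * ((‖v‖ + 1) * r)) ^ d := by positivity
      have h1 : volume (B ∩ P) + volume (B \ P) = volume B := measure_inter_add_sdiff B hPm
      have h2 : volume B = ENNReal.ofReal ((1 - θ) * (2 * ((‖v‖ + 1) * r)) ^ d) +
          ENNReal.ofReal (θ * (2 * ((‖v‖ + 1) * r)) ^ d) := by
        rw [hvolB, ← ENNReal.ofReal_add (mul_nonneg (by linarith) hb.le) (by positivity)]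
        congr 1
        ring
      have h3 : θ * (2 * ((‖v‖ + 1) * r)) ^ d = (2 * (η * r)) ^ d / 2 := by
        have hv1 : (‖v‖ + 1) ≠ 0 := by positivity
        have e : η / (‖v‖ + 1) * (2 * ((‖v‖ + 1) * r)) = 2 * (η * r) := by
          field_simp
        rw [hθ, mul_assoc, ← mul_pow, e]
        ring
      have h4 : ENNReal.ofReal ((1 - θ) * (2 * ((‖v‖ + 1) * r)) ^ d) ≤ volume (B ∩ P) := by
        rw [ENNReal.ofReal_mul (by linarith), ← hvolB, inter_comm]
        exact hPB
      rw [← h3]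
      refine ENNReal.le_of_add_le_add_left (a := volume (B ∩ P)) ?_ ?_
      · exact ne_top_of_le_ne_top hBtop (measure_mono inter_subset_left)
      · calc volume (B ∩ P) + volume (B \ P) = volume B := h1
          _ = ENNReal.ofReal ((1 - θ) * (2 * ((‖v‖ + 1) * r)) ^ d) +
                ENNReal.ofReal (θ * (2 * ((‖v‖ + 1) * r)) ^ d) := h2
          _ ≤ volume (B ∩ P) + ENNReal.ofReal (θ * (2 * ((‖v‖ + 1) * r)) ^ d) :=
              add_le_add h4 le_rfl
    have hQvol' : ENNReal.ofReal ((2 * (η * r)) ^ d / 2) ≤ volume Q := by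
      have h1 : closedBall (u + r • v) (η * r) ⊆ Q ∪ (B \ P) := by
        intro y hy
        by_cases hyP : y ∈ P
        · exact Or.inl ⟨hyP, hy⟩
        · exact Or.inr ⟨hQB hy, hyP⟩
      have h2 : volume (closedBall (u + r • v) (η * r)) ≤ volume Q + volume (B \ P) :=
        (measure_mono h1).trans (measure_union_le _ _)
      rw [hvolb] at h2
      have h3 : ENNReal.ofReal ((2 * (η * r)) ^ d) =
          ENNReal.ofReal ((2 * (η * r)) ^ d / 2) + ENNReal.ofReal ((2 * (η * r)) ^ d / 2) := by
        rw [← ENNReal.ofReal_add (by positivity) (by positivity)]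
        congr 1; ring
      rw [h3] at h2
      exact ENNReal.le_of_add_le_add_right ENNReal.ofReal_ne_top (h2.trans (add_le_add le_rfl hdiffP))
    -- (5) assemble
    have hr_d : ENNReal.ofReal (r ^ d) ≠ 0 := by
      rw [Ne, ENNReal.ofReal_eq_zero, not_le]; positivity
    have hmain : ENNReal.ofReal ((2 * η) ^ d / 2) * ENNReal.ofReal (r ^ d) / (K : ℝ≥0∞) ^ d ≤
        ν (closedBall x (M * r)) := by
      rw [← ENNReal.ofReal_mul (by positivity)]
      have e : (2 * η) ^ d / 2 * r ^ d = (2 * (η * r)) ^ d / 2 := by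
        simp only [mul_pow]
        ring
      rw [e]
      refine (ENNReal.div_le_of_le_mul' ?_).trans hν
      calc ENNReal.ofReal ((2 * (η * r)) ^ d / 2) ≤ volume Q := hQvol'
        _ = μH[d] Q := hQvol.symm
        _ ≤ (K : ℝ≥0∞) ^ d * μH[d] (g '' Q) := hanti
    rw [ENNReal.le_div_iff_mul_le (Or.inl (mul_ne_zero (unitBallVolume_ne_zero_ne_top d).1 ?_))
      (Or.inl (ENNReal.mul_ne_top (unitBallVolume_ne_zero_ne_top d).2 ENNReal.ofReal_ne_top))]
    swap
    · rw [Ne, ENNReal.ofReal_eq_zero, not_le]; positivity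
    calc κ * (unitBallVolume d * ENNReal.ofReal ((M * r) ^ d))
        = κ * (unitBallVolume d * ENNReal.ofReal (M ^ d)) * ENNReal.ofReal (r ^ d) := by
          rw [mul_pow, ENNReal.ofReal_mul (by positivity)]; ring
      _ = (ENNReal.ofReal ((2 * η) ^ d / 2) / (K : ℝ≥0∞) ^ d) * ENNReal.ofReal (r ^ d) := by
          rw [hκ, ENNReal.div_mul_cancel]
          · exact mul_ne_zero (unitBallVolume_ne_zero_ne_top d).1
              (by rw [Ne, ENNReal.ofReal_eq_zero, not_le]; positivity)
          · exact ENNReal.mul_ne_top (unitBallVolume_ne_zero_ne_top d).2 ENNReal.ofReal_ne_top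
      _ = ENNReal.ofReal ((2 * η) ^ d / 2) * ENNReal.ofReal (r ^ d) / (K : ℝ≥0∞) ^ d := by
          rw [ENNReal.mul_div_right_comm]
      _ ≤ ν (closedBall x (M * r)) := hmain
  -- the upper density is at least `κ > 0`: contradiction
  have hfreq : ∃ᶠ ρ in 𝓝[>] (0 : ℝ),
      κ ≤ ν (closedBall x ρ) / (unitBallVolume d * ENNReal.ofReal (ρ ^ d)) := by
    have hsc : Tendsto (fun r : ℝ => M * r) (𝓝[>] 0) (𝓝[>] 0) := by
      refine tendsto_nhdsWithin_iff.2 ⟨?_, ?_⟩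
      · have : Tendsto (fun r : ℝ => M * r) (𝓝 0) (𝓝 (M * 0)) := tendsto_const_nhds.mul tendsto_id
        rw [mul_zero] at this
        exact this.mono_left nhdsWithin_le_nhds
      · filter_upwards [self_mem_nhdsWithin] with r hr
        change 0 < M * r
        exact mul_pos hM0 hr
    have h1 : ∀ᶠ r in 𝓝[>] (0 : ℝ),
        κ ≤ ν (closedBall x (M * r)) / (unitBallVolume d * ENNReal.ofReal ((M * r) ^ d)) := by
      filter_upwards [hgood] with r hr using hkey r hr.1 hr.2.1 hr.2.2.1 hr.2.2.2
    exact hsc.frequently h1.frequently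
  have hle : κ ≤ upperDensity d ν x := le_limsup_of_frequently_le hfreq
  rw [hS] at hle
  exact hκ0 (nonpos_iff_eq_zero.1 hle)

end Core

/-! ### The almost-everywhere statement -/

section AE

variable {ι : Type*} [Fintype ι] {V : Type*} [NormedAddCommGroup V] [NormedSpace ℝ V]
  [FiniteDimensional ℝ V] [MeasurableSpace V] [BorelSpace V]

omit [FiniteDimensional ℝ V] [MeasurableSpace V] [BorelSpace V] in
/-- On a piece where `g` is `c/4`-approximated by a linear map `A` with `‖A v‖ ≥ c ‖v‖`, the map
`g` is anti-Lipschitz with constant `2/c` (`‖g x - g y‖ ≥ (3c/4) ‖x - y‖`). [folklore] -/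
theorem antilipschitz_restrict_of_approximatesLinearOn {g : (ι → ℝ) → V}
    {A : (ι → ℝ) →L[ℝ] V} {P : Set (ι → ℝ)} {c : ℝ≥0} (hc : 0 < c)
    (hA : ∀ v, (c : ℝ) * ‖v‖ ≤ ‖A v‖) (happ : ApproximatesLinearOn g A P (c / 4)) :
    AntilipschitzWith (2 / c) (P.restrict g) := by
  refine AntilipschitzWith.of_le_mul_dist fun p q => ?_
  have h1 := happ p p.2 q q.2
  have h2 := hA ((p : ι → ℝ) - q)
  rw [Subtype.dist_eq, dist_eq_norm, dist_eq_norm]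
  change ‖(p : ι → ℝ) - q‖ ≤ ↑(2 / c) * ‖g p - g q‖
  have h3 : ‖A ((p : ι → ℝ) - q)‖ ≤ ‖g p - g q‖ + ‖g p - g q - A ((p : ι → ℝ) - q)‖ :=
    calc ‖A ((p : ι → ℝ) - q)‖ = ‖(g p - g q) - (g p - g q - A ((p : ι → ℝ) - q))‖ := by
          congr 1; abel
      _ ≤ ‖g p - g q‖ + ‖g p - g q - A ((p : ι → ℝ) - q)‖ := norm_sub_le _ _
  have hc' : (0 : ℝ) < c := hc
  rw [NNReal.coe_div, NNReal.coe_ofNat]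
  rw [NNReal.coe_div, NNReal.coe_ofNat] at h1
  have h4 : (c : ℝ) * ‖(p : ι → ℝ) - q‖ ≤ ‖g p - g q‖ + c / 4 * ‖(p : ι → ℝ) - q‖ :=
    h2.trans (h3.trans (add_le_add le_rfl h1))
  have h5 : 0 ≤ (c : ℝ) * ‖(p : ι → ℝ) - q‖ := by positivity
  rw [div_mul_eq_mul_div, le_div_iff₀ hc']
  nlinarith [h4, h5]

/-- **The image of the differential of a Lipschitz parametrisation consists of approximate tangent
vectors** (Federer 3.2.19, inclusion `im Dg(u) ⊆ Tan^d(𝓗ᵈ ⌞ W, g u)`, unpacked through the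
definition `Tan^d(μ, a) = ⋂ {Tan(S, a) : Θ^d(μ ⌞ Sᶜ, a) = 0}` of 3.2.16). Let `g : ℝ^ι → V` be
Lipschitz, `W ⊆ V` measurable, `d = #ι`. For a.e. `u` such that `g u ∈ W` and `g` is
differentiable at `u` with injective differential: whenever `S ⊆ V` has
`Θ*ᵈ(𝓗ᵈ ⌞ W ⌞ Sᶜ, g u) = 0`, every vector `Dg(u) v` belongs to `Tan(S, g u)`.
[cite: Federer1969, 3.2.19 (with 3.2.16)] -/
theorem fderiv_apply_mem_posTangentConeAt_ae {g : (ι → ℝ) → V} {L : ℝ≥0}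
    (hg : LipschitzWith L g) {W : Set V} (hW : MeasurableSet W) :
    ∀ᵐ u ∂(volume : Measure (ι → ℝ)), g u ∈ W → DifferentiableAt ℝ g u →
      Injective (fderiv ℝ g u) → ∀ S : Set V,
        upperDensity (Fintype.card ι)
          (((μH[Fintype.card ι] : Measure V).restrict W).restrict Sᶜ) (g u) = 0 →
        ∀ v, fderiv ℝ g u v ∈ posTangentConeAt S (g u) := by
  classical
  -- the classes `I n` of points with differential bounded below by `1/(n+1)`
  let cN : ℕ → ℝ≥0 := fun n => 1 / ((n : ℝ≥0) + 1)
  have hcN : ∀ n, 0 < cN n := fun n => by positivity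
  have hcNr : ∀ n, ((cN n : ℝ≥0) : ℝ) = 1 / ((n : ℝ) + 1) := fun n => by simp [cN]
  let I : ℕ → Set (ι → ℝ) := fun n =>
    {u | DifferentiableAt ℝ g u ∧ ∀ v, ((cN n : ℝ≥0) : ℝ) * ‖v‖ ≤ ‖fderiv ℝ g u v‖}
  let s : ℕ → Set (ι → ℝ) := fun n => g ⁻¹' W ∩ I n
  have hsm : ∀ n, MeasurableSet (s n) := by
    intro n
    refine (hg.continuous.measurable hW).inter ?_
    have hc : IsClosed {A : (ι → ℝ) →L[ℝ] V | ∀ v, ((cN n : ℝ≥0) : ℝ) * ‖v‖ ≤ ‖A v‖} := by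
      rw [setOf_forall]
      refine isClosed_iInter fun v => isClosed_le continuous_const ?_
      exact (ContinuousLinearMap.apply ℝ V v).continuous.norm
    have : I n = {u | DifferentiableAt ℝ g u} ∩ (fderiv ℝ g) ⁻¹'
        {A : (ι → ℝ) →L[ℝ] V | ∀ v, ((cN n : ℝ≥0) : ℝ) * ‖v‖ ≤ ‖A v‖} := rfl
    rw [this]
    exact (measurableSet_of_differentiableAt ℝ g).inter (measurable_fderiv ℝ g hc.measurableSet)
  -- partitions into pieces of linear approximation at precision `cN n / 4`
  have hpart : ∀ n, ∃ (t : ℕ → Set (ι → ℝ)) (A : ℕ → (ι → ℝ) →L[ℝ] V),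
      (∀ k, MeasurableSet (t k)) ∧ (s n ⊆ ⋃ k, t k) ∧
      (∀ k, ApproximatesLinearOn g (A k) (s n ∩ t k) (cN n / 4)) ∧
      ((s n).Nonempty → ∀ k, ∃ y ∈ s n, A k = fderiv ℝ g y) := by
    intro n
    obtain ⟨t, A, -, htm, hst, happ, hA⟩ :=
      exists_partition_approximatesLinearOn_of_hasFDerivWithinAt g (s n) (fderiv ℝ g)
        (fun u hu => hu.2.1.hasFDerivAt.hasFDerivWithinAt) (fun _ => cN n / 4)
        (fun _ => (div_pos (hcN n) (by norm_num)).ne')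
    exact ⟨t, A, htm, hst, happ, hA⟩
  choose t A htm hst happ hAs using hpart
  -- reduction to the pieces
  suffices H : ∀ n k, ∀ᵐ u ∂(volume : Measure (ι → ℝ)), u ∈ s n ∩ t n k →
      ∀ S : Set V, upperDensity (Fintype.card ι)
        (((μH[Fintype.card ι] : Measure V).restrict W).restrict Sᶜ) (g u) = 0 →
        ∀ v, fderiv ℝ g u v ∈ posTangentConeAt S (g u) by
    have H' := ae_all_iff.2 fun n => ae_all_iff.2 fun k => H n k
    filter_upwards [H'] with u hu huW hdiff hinj S hS v
    -- `Dg(u)` is bounded below by some `1/(n+1)`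
    obtain ⟨K, hK0, hK⟩ := (fderiv ℝ g u : (ι → ℝ) →ₗ[ℝ] V).exists_antilipschitzWith
      (LinearMap.ker_eq_bot.2 hinj)
    obtain ⟨n, hn⟩ := exists_nat_ge (K : ℝ)
    have huI : u ∈ I n := by
      refine ⟨hdiff, fun y => ?_⟩
      have h1 : ‖y‖ ≤ K * ‖fderiv ℝ g u y‖ := by
        have := hK.le_mul_dist y 0
        simpa [dist_eq_norm] using this
      rw [hcNr n, one_div, inv_mul_le_iff₀ (by positivity)]
      calc ‖y‖ ≤ K * ‖fderiv ℝ g u y‖ := h1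
        _ ≤ ((n : ℝ) + 1) * ‖fderiv ℝ g u y‖ :=
            mul_le_mul_of_nonneg_right (by linarith) (norm_nonneg _)
    have hus : u ∈ s n := ⟨huW, huI⟩
    obtain ⟨k, hk⟩ := mem_iUnion.1 (hst n hus)
    exact hu n k ⟨hus, hk⟩ S hS v
  intro n k
  have hP := Besicovitch.ae_tendsto_measure_inter_div (volume : Measure (ι → ℝ)) (s n ∩ t n k)
  filter_upwards [ae_imp_of_ae_restrict hP] with u hdens hu S hS v
  have hdens' := hdens hu
  -- anti-Lipschitz on the piece
  obtain ⟨y, hy, hAy⟩ := hAs n ⟨u, hu.1⟩ k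
  have hanti : AntilipschitzWith (2 / cN n) ((s n ∩ t n k).restrict g) :=
    antilipschitz_restrict_of_approximatesLinearOn (hcN n) (fun w => by rw [hAy]; exact hy.2.2 w)
      (happ n k)
  exact fderiv_apply_mem_posTangentConeAt_of_density ((hsm n).inter (htm n k)) hanti
    (fun z hz => hz.1.1) hu.1.2.1 hdens' hS v

end AE

end Literature.Geometry.GeometricMeasureTheory
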